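import Summits.NavierStokesRegularity.NavierStokesRegularity.Theorems.StretchingWellBindingEnstrophyQuarterLawStubSieve
import Summits.NavierStokesRegularity.NavierStokesRegularity.Theorems.StretchingWellBindingEnstrophyQuarterLawStubSmoothingEnvelope
import Summits.NavierStokesRegularity.NavierStokesRegularity.Theorems.StretchingWellBindingEnstrophyQuarterLawStubFarFieldEnstrophy
import Summits.NavierStokesRegularity.NavierStokesRegularity.Theorems.StretchingWellBindingEnstrophyQuarterLawWindowToSlice
import Summits.NavierStokesRegularity.NavierStokesRegularity.Theorems.StretchingWellBindingEnstrophyQuarterLawSparseSieveCharacterisation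
import Summits.NavierStokesRegularity.NavierStokesRegularity.Theorems.TypeIQuarterGateQuarterLawTypeIUniformLocalTypeI
import Summits.NavierStokesRegularity.NavierStokesRegularity.Theses.StretchingWellBinding
import Summits.NavierStokesRegularity.NavierStokesRegularity.Theses.TypeILiouville
import HarnessLib

/-!
# Shelf crux `EnstrophyQuarterLaw` (stmt-NavierStokesRegularity-1574), line «sparse_sieve»:
# the registered skeleton IN THE TREE'S VOCABULARY — composition and exact status of the open stubs

`--supports stmt-NavierStokesRegularity-1574 --as helper`. With the five skeleton predicates importable
(`…SparseSieveDefs`, p817378) and stubs 3/4/5 retired by name (`Registered.stub_smoothingEnvelope` p817441,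
`Registered.stub_farFieldEnstrophy` p817442, `Registered.stub_sieve` p817443; stub 7 `stub_windowToSlice` = p608800),
this file states, in exactly the registered signatures (`UniformLocalTypeI T u`, `UniformSparseness T u`, …):

* `enstrophyQuarterLaw_of_stubs` — THE SKELETON THEOREM, Theorems-side: the three OPEN registered stubs
  `stub_uniformLocalTypeI` (S1), `stub_uniformSparseness` (S2), `stub_noTypeII` (= `TypeIliouvilleNoTypeII`,
  stmt-0056), taken as hypotheses with their registered signatures verbatim, imply the crux BY NAME — the same
  composition as `Cruxes/EnstrophyQuarterLaw/Lines/sparse_sieve.lean`'s `EnstrophyQuarterLaw_of`, now importable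
  (the Cruxes module is not);
* `stub_uniformLocalTypeI_of_stub_noTypeII` — stub 6 ⟹ stub 1 (S1 is absorbed by 0056; content
  `CountQuarterLaw.uniformLocalTypeI_of_isTypeIBlowup`, p816193/p816754, Seregin 2014 Prop. 3.11 (i));
* `stub_uniformLocalTypeI_of_enstrophyQuarterLaw`, `stub_uniformSparseness_of_enstrophyQuarterLaw` — the crux
  implies each open velocity-side stub (no-loss certificates p619704, p816651, folded);
* `enstrophyQuarterLaw_iff_stub_noTypeII_and_stub_uniformSparseness` — **EXACT STATUS**:
  `EnstrophyQuarterLaw ⟺ stub_noTypeII ∧ (∀ first blow-ups, UniformSparseness)`: beyond the sibling crux 0056 the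
  quarter law's open content is UNIFORM SPARSENESS ALONE (census decomp-ns g36 reading `eql_iff_u_and_s2`, here a
  tree theorem in the registered vocabulary);
* `enstrophyQuarterLaw_iff_stubs` — `EnstrophyQuarterLaw ⟺ 0056 ∧ (∀ S1) ∧ (∀ S2)` (p816722, folded).

HONEST FRAMING: implications/equivalences between OPEN statements; `EnstrophyQuarterLaw` (1574),
`TypeIliouvilleNoTypeII` (0056), S1 and S2 stay OPEN; nothing here bears on Navier–Stokes regularity; no summit
statement is proved.
-/

noncomputable section

-- the summit and its single sub-problem share the name (CONVENTIONS §1), as in every Theorems file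
set_option linter.dupNamespace false

namespace Summit.NavierStokesRegularity.NavierStokesRegularity.Theorems.EnstrophyQuarterLaw.SparseSieve.Registered

open MeasureTheory Set Metric
open Literature.Analysis.FluidPDE
open scoped ENNReal

/-- **The skeleton theorem of line «sparse_sieve», Theorems-side.** The three OPEN registered stubs — S1
`stub_uniformLocalTypeI`, S2 `stub_uniformSparseness` (signatures verbatim) and stub 6 `stub_noTypeII`
(= `TypeIliouvilleNoTypeII`, stmt-0056) — imply the crux `EnstrophyQuarterLaw` BY NAME: the window law from the
sieve (`Registered.stub_sieve`, fed S1, S2, `Registered.stub_smoothingEnvelope`, `Registered.stub_farFieldEnstrophy`),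
then the slice law from sup-rate Type I by the converter `EnstrophyQuarterLaw.stub_windowToSlice`. Conditional on
three OPEN statements; no summit statement is proved. [folklore] -/
theorem enstrophyQuarterLaw_of_stubs
    (hS1 : ∀ (ν T : ℝ), 0 < ν → 0 < T →
      ∀ (u : ℝ → EuclideanSpace ℝ (Fin 3) → EuclideanSpace ℝ (Fin 3))
        (p : ℝ → EuclideanSpace ℝ (Fin 3) → ℝ),
      IsMaximalSmoothSolution ν 0 u p T → IsLerayHopfOn T ν 0 (u 0) u →
      HasRapidSpatialDecay (u 0) → UniformLocalTypeI T u)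
    (hS2 : ∀ (ν T : ℝ), 0 < ν → 0 < T →
      ∀ (u : ℝ → EuclideanSpace ℝ (Fin 3) → EuclideanSpace ℝ (Fin 3))
        (p : ℝ → EuclideanSpace ℝ (Fin 3) → ℝ),
      IsMaximalSmoothSolution ν 0 u p T → IsLerayHopfOn T ν 0 (u 0) u →
      HasRapidSpatialDecay (u 0) → UniformSparseness T u)
    (hS6 : Summit.NavierStokesRegularity.NavierStokesRegularity.Theses.TypeILiouville.TypeIliouvilleNoTypeII) :
    Summit.NavierStokesRegularity.NavierStokesRegularity.Theses.StretchingWellBinding.EnstrophyQuarterLaw := by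
  intro ν T hν hT u p hmax hLH hdec
  exact EnstrophyQuarterLaw.stub_windowToSlice ν T hν hT u p hmax hLH hdec (hS6 ν T hν hT u p hmax hLH hdec)
    (stub_sieve ν T hν hT u p hmax hLH hdec
      (hS1 ν T hν hT u p hmax hLH hdec)
      (hS2 ν T hν hT u p hmax hLH hdec)
      (stub_smoothingEnvelope ν T hν hT u p hmax hLH hdec)
      (stub_farFieldEnstrophy ν T hν hT u p hmax hLH hdec))

/-- **Stub 6 ⟹ stub 1** in the registered signatures: under `TypeIliouvilleNoTypeII` (stmt-0056) every first
blow-up is uniformly locally Type I in the CKN quantities `A`, `E` (`UniformLocalTypeI T u`). Content: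
`CountQuarterLaw.uniformLocalTypeI_of_isTypeIBlowup` (Seregin 2014 Prop. 3.11 (i) / Albritton–Barker L. 2.6, tree
theorem). Implication between OPEN statements. [folklore] -/
theorem stub_uniformLocalTypeI_of_stub_noTypeII
    (hS6 : Summit.NavierStokesRegularity.NavierStokesRegularity.Theses.TypeILiouville.TypeIliouvilleNoTypeII) :
    ∀ (ν T : ℝ), 0 < ν → 0 < T →
      ∀ (u : ℝ → EuclideanSpace ℝ (Fin 3) → EuclideanSpace ℝ (Fin 3))
        (p : ℝ → EuclideanSpace ℝ (Fin 3) → ℝ),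
      IsMaximalSmoothSolution ν 0 u p T → IsLerayHopfOn T ν 0 (u 0) u →
      HasRapidSpatialDecay (u 0) → UniformLocalTypeI T u := by
  intro ν T hν hT u p hmax hLH hdec
  exact CountQuarterLaw.uniformLocalTypeI_of_isTypeIBlowup hν hT hmax.1 hLH hdec
    (hS6 ν T hν hT u p hmax hLH hdec)

/-- **The crux ⟹ stub 1** (no-loss certificate for S1 in the registered signature): `EnstrophyQuarterLaw` implies
`UniformLocalTypeI T u` at every first blow-up (p619704 / p816651, folded). Implication between OPEN statements.
[folklore] -/
theorem stub_uniformLocalTypeI_of_enstrophyQuarterLaw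
    (hQ : Summit.NavierStokesRegularity.NavierStokesRegularity.Theses.StretchingWellBinding.EnstrophyQuarterLaw) :
    ∀ (ν T : ℝ), 0 < ν → 0 < T →
      ∀ (u : ℝ → EuclideanSpace ℝ (Fin 3) → EuclideanSpace ℝ (Fin 3))
        (p : ℝ → EuclideanSpace ℝ (Fin 3) → ℝ),
      IsMaximalSmoothSolution ν 0 u p T → IsLerayHopfOn T ν 0 (u 0) u →
      HasRapidSpatialDecay (u 0) → UniformLocalTypeI T u :=
  (SparseSieveCharacterisation.uniformLocalTypeI_and_uniformSparseness_of_enstrophyQuarterLaw hQ).1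

/-- **The crux ⟹ stub 2** (no-loss certificate for S2 in the registered signature): `EnstrophyQuarterLaw` implies
`UniformSparseness T u` at every first blow-up (p816651, folded). Implication between OPEN statements.
[folklore] -/
theorem stub_uniformSparseness_of_enstrophyQuarterLaw
    (hQ : Summit.NavierStokesRegularity.NavierStokesRegularity.Theses.StretchingWellBinding.EnstrophyQuarterLaw) :
    ∀ (ν T : ℝ), 0 < ν → 0 < T →
      ∀ (u : ℝ → EuclideanSpace ℝ (Fin 3) → EuclideanSpace ℝ (Fin 3))
        (p : ℝ → EuclideanSpace ℝ (Fin 3) → ℝ),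
      IsMaximalSmoothSolution ν 0 u p T → IsLerayHopfOn T ν 0 (u 0) u →
      HasRapidSpatialDecay (u 0) → UniformSparseness T u :=
  SparseSieveCharacterisation.uniformSparseness_of_enstrophyQuarterLaw hQ

/-- **EXACT STATUS of the line in the registered vocabulary:
`EnstrophyQuarterLaw ⟺ stub_noTypeII ∧ (∀ first blow-ups, UniformSparseness)`.** Beyond the sibling crux
`TypeIliouvilleNoTypeII` (stmt-0056, stub 6) the open content of the quarter law is the uniform-sparseness stub S2
ALONE (S1 is absorbed by stub 6, `stub_uniformLocalTypeI_of_stub_noTypeII`). `→`: 0056 from the crux by the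
record-time capacity lemma (p816722) and S2 by its certificate; `←`: `enstrophyQuarterLaw_of_stubs`.
Equivalence of OPEN statements; neither side is asserted; no summit statement is proved. [folklore] -/
theorem enstrophyQuarterLaw_iff_stub_noTypeII_and_stub_uniformSparseness :
    Summit.NavierStokesRegularity.NavierStokesRegularity.Theses.StretchingWellBinding.EnstrophyQuarterLaw ↔
    (Summit.NavierStokesRegularity.NavierStokesRegularity.Theses.TypeILiouville.TypeIliouvilleNoTypeII ∧
     ∀ (ν T : ℝ), 0 < ν → 0 < T →
      ∀ (u : ℝ → EuclideanSpace ℝ (Fin 3) → EuclideanSpace ℝ (Fin 3))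
        (p : ℝ → EuclideanSpace ℝ (Fin 3) → ℝ),
      IsMaximalSmoothSolution ν 0 u p T → IsLerayHopfOn T ν 0 (u 0) u →
      HasRapidSpatialDecay (u 0) → UniformSparseness T u) := by
  refine ⟨fun hQ => ?_, fun h => enstrophyQuarterLaw_of_stubs (stub_uniformLocalTypeI_of_stub_noTypeII h.1) h.2 h.1⟩
  have h := (SparseSieveCharacterisation.enstrophyQuarterLaw_iff_noTypeII_and_uniformLocalTypeI_and_uniformSparseness).1 hQ
  exact ⟨h.1, h.2.2⟩

/-- **The exact decomposition of p816722, folded into the registered vocabulary:**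
`EnstrophyQuarterLaw ⟺ stub_noTypeII ∧ (∀ first blow-ups, UniformLocalTypeI) ∧ (∀ first blow-ups, UniformSparseness)`
— the line's three OPEN stubs, verbatim. Equivalence of OPEN statements; no summit statement is proved. [folklore] -/
theorem enstrophyQuarterLaw_iff_stubs :
    Summit.NavierStokesRegularity.NavierStokesRegularity.Theses.StretchingWellBinding.EnstrophyQuarterLaw ↔
    (Summit.NavierStokesRegularity.NavierStokesRegularity.Theses.TypeILiouville.TypeIliouvilleNoTypeII ∧
     (∀ (ν T : ℝ), 0 < ν → 0 < T →
      ∀ (u : ℝ → EuclideanSpace ℝ (Fin 3) → EuclideanSpace ℝ (Fin 3))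
        (p : ℝ → EuclideanSpace ℝ (Fin 3) → ℝ),
      IsMaximalSmoothSolution ν 0 u p T → IsLerayHopfOn T ν 0 (u 0) u →
      HasRapidSpatialDecay (u 0) → UniformLocalTypeI T u) ∧
     (∀ (ν T : ℝ), 0 < ν → 0 < T →
      ∀ (u : ℝ → EuclideanSpace ℝ (Fin 3) → EuclideanSpace ℝ (Fin 3))
        (p : ℝ → EuclideanSpace ℝ (Fin 3) → ℝ),
      IsMaximalSmoothSolution ν 0 u p T → IsLerayHopfOn T ν 0 (u 0) u →
      HasRapidSpatialDecay (u 0) → UniformSparseness T u)) :=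
  SparseSieveCharacterisation.enstrophyQuarterLaw_iff_noTypeII_and_uniformLocalTypeI_and_uniformSparseness

end Summit.NavierStokesRegularity.NavierStokesRegularity.Theorems.EnstrophyQuarterLaw.SparseSieve.Registered

end
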